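import Summits.MatrixMultiplication.MatrixMultiplication.Theorems.SevenEighthsLaw.Negative.SharpConstants

/-!
# `FidelityWitnesses.SevenEighthsLaw` (stmt-MatrixMultiplication-4959) — Negative lane:
# ALL SIX spanning vectors must be rank one ("five triads + one biad" breaks `7`)

Load-bearing analysis for the line `singlet-fraction-transfer` (stub `stub_capHardRegime`, E-picture
`cap(E) = Σ_a ‖P_E T_a‖² ≤ 7` for product-spanned 6-planes `E ⊂ X ⊗ Y`): the hypothesis that EVERY one of
the six spanning vectors of `E` is a product `u ⊗ v` is used.  Relax ONE of them to an arbitrary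
`F ∈ X ⊗ Y` — in tensor language, allow `S = Σ_{r<5} w_r ⊗ u_r ⊗ v_r + d ⊗ F` ("five triads + one biad") —
and the `7/8` bound fails by an explicit INTEGER witness of ratio `37/5 = 7.4`:
the five products are five of the six transported Strassen products `sixU r ⊗ sixV r` (`r < 5`) of
`SharpConstants` (the plane `U*` of `⟨2,2,2⟩ − a₂₂⊗b₂₂⊗c₂₂` minus its standard product `x₂₁ ⊗ y₁₂`),
`F = −T₁₁ − T₁₂ + T₂₁ + 2·T₂₂` is the slice-space vector orthogonal to those five products
(`T_{κν} = Σ_μ x_{κμ} ⊗ y_{μν}` the output slices of `⟨2,2,2⟩`), and `w, d` are the optimal output factors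
(exact projection, denominators cleared: `35 · Σ_a z_a ⊗ P_E T_a`, `E = span{five products, F}`,
`cap(E) = 27/5 + 2 = 37/5`).  Overlap `259`, squared norm `9065`, `259² = 67081 > 63455 = 7·9065`.
(The supremum of this relaxation is even `8`: Bini's five border products for `⟨2,2,2⟩ ∖ c₁₁` plus the
free vector `T₁₁`.)  Refuter seat drefute-g2, 2026-08-16; pure arithmetic (`decide`), no new definitions.
-/

namespace Summit.MatrixMultiplication.MatrixMultiplication.Theorems

open scoped BigOperators
open Literature.Computability.AlgebraicComplexity
open SevenEighthsLawNeg

/-- **"Five triads + one biad" breaks the `7/8` law.**  If one of the six rank-one terms of `S` is relaxed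
to a biad `d ⊗ F` with `F ∈ X ⊗ Y` arbitrary, the inequality `|⟨S,⟨2,2,2⟩⟩|² ≤ 7‖S‖²` is FALSE: the integer
witness below (five transported Strassen products `sixU r ⊗ sixV r`, `r < 5`, free sixth vector
`F = −T₁₁ − T₁₂ + T₂₁ + 2T₂₂`, optimal output factors) has ratio `259²/9065 = 37/5`.  For the line lead: in
the E-picture, `cap ≤ 7` uses that ALL six spanning vectors of the plane are products (five products plus a
free sixth vector reach `37/5` honestly, `8` in the limit). [folklore] -/
theorem sevenEighthsLaw_false_fiveTriadsOneBiad :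
    ¬ (∀ (w u v : Fin 5 → P2 → ℂ) (d : P2 → ℂ) (F : P2 → P2 → ℂ),
        ‖∑ a, ∑ b, ∑ c, ((∑ r, w r a * u r b * v r c) + d a * F b c) * matMulTensor ℂ 2 2 2 a b c‖ ^ 2
          ≤ 7 * ∑ a, ∑ b, ∑ c, ‖(∑ r, w r a * u r b * v r c) + d a * F b c‖ ^ 2) := by
  -- integer data: output factors of the five triads, output factor of the biad, the free vector `F`
  let W5 : Fin 5 → P2 → ℤ :=
    ![vec4 14 14 (-14) 21, vec4 7 7 28 (-7), vec4 (-7) 28 7 7, vec4 21 21 14 14, vec4 (-21) 14 21 (-14)]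
  let U5 : Fin 5 → P2 → ℤ := ![vec4 1 1 1 0, vec4 1 1 1 1, vec4 0 1 0 0, vec4 1 0 1 0, vec4 1 1 0 0]
  let V5 : Fin 5 → P2 → ℤ :=
    ![vec4 (-1) 1 1 0, vec4 0 0 1 0, vec4 1 (-1) (-1) 1, vec4 1 0 (-1) 0, vec4 (-1) 1 0 0]
  let D5 : P2 → ℤ := vec4 (-5) (-5) 5 10
  let F5 : P2 → P2 → ℤ := fun b c => if b.2 = c.1 then vec4 (-1) (-1) 1 2 (b.1, c.2) else 0
  let S5 : P2 → P2 → P2 → ℤ := fun a b c => (∑ r, W5 r a * U5 r b * V5 r c) + D5 a * F5 b c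
  have hv : overlapZ S5 = 259 ∧ normSqZ S5 = 9065 := by decide
  intro h
  have h1 := h (fun r a => (W5 r a : ℂ)) (fun r b => (U5 r b : ℂ)) (fun r c => (V5 r c : ℂ))
    (fun a => (D5 a : ℂ)) (fun b c => (F5 b c : ℂ))
  have key : ∀ a b c : P2,
      ((∑ r : Fin 5, (W5 r a : ℂ) * (U5 r b : ℂ) * (V5 r c : ℂ)) + (D5 a : ℂ) * (F5 b c : ℂ))
        = castT S5 a b c := by
    intro a b c
    simp [castT, S5]
  simp only [key] at h1
  rw [(ratio_castT S5).1, (ratio_castT S5).2, hv.1, hv.2] at h1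
  norm_num at h1

end Summit.MatrixMultiplication.MatrixMultiplication.Theorems
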